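import Mathlib
import HarnessLib

/-!
# The truncated `K`-moment problem: strict `K`-positivity of the Riesz functional gives a
# representing measure (Fialkow–Nie 2010, Thm. 1.3)

L. Fialkow, J. Nie, *Positivity of Riesz functionals and solutions of quadratic and quartic moment
problems*, J. Funct. Anal. **258** (2010) 328–356 (arXiv:0908.3230), §1.

Setting (§1, p. 1 of the arXiv version). A real multisequence `y = (y_α)_{α ∈ ℤ₊ⁿ, |α| ≤ k}` of
degree `k` in `n` variables (a *truncated moment sequence*), `K ⊆ ℝⁿ` a CLOSED set. `y` has a
*`K`-representing measure* if there is a positive Borel measure `μ` on `ℝⁿ`, supported in `K`, with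
`y_α = ∫ x^α dμ(x)` for all `|α| ≤ k` (eq. (1.1)). The *Riesz functional* `L_y : 𝒫_k → ℝ`,
`L_y(Σ p_α x^α) = Σ p_α y_α`, on the polynomials of degree `≤ k`. `L_y` is *`K`-positive* if
`L_y(p) ≥ 0` for all `p ∈ 𝒫_k` with `p|_K ≥ 0`, and *strictly `K`-positive* if moreover `L_y(p) > 0`
whenever `p|_K ≥ 0` and `p|_K ≢ 0`. `K` is a *determining set (of degree `k`)* if `p ∈ 𝒫_k`,
`p|_K ≡ 0` imply `p ≡ 0` (sets with non-empty interior are determining).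

**Theorem 1.3.** "Suppose `K` is a determining set of degree `k` and let `y` be a truncated moment
sequence of degree `k` in `n` variables. If `L_y` is strictly `K`-positive, then `y` admits a
`K`-representing measure."

Consequence used by route `AnomalousDissipation/MomentParity` (op. cit. §1, discussion of
`(H_{n,d})` and Hilbert's theorem: `(H_{n,1})` holds for every `n`, i.e. every non-negative
polynomial of degree `≤ 2` is a sum of squares of affine polynomials): for ODD degree `k = 2d + 1`
a polynomial non-negative on `ℝⁿ` has degree `≤ 2d`, so for `k = 3`, `K = ℝⁿ`, strict positivity of
`L_y` is equivalent to positive DEFINITENESS of the first-order moment matrix `M_1(y)` (`L_y(p²) > 0`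
for affine `p ≠ 0`); hence ANY prescribed third moments together with a positive definite `M_1(y)`
(mean and covariance block) are the moments of a positive Borel measure on `ℝⁿ` — "odd-order
realizability is vacuous once the covariance is definite", the parity half of
`Summit.AnomalousDissipation.AnomalousDissipation.Theses.MomentParity.CubicParityLoud`
(item stmt-AnomalousDissipation-11465), and the reason the first genuine positivity constraint of
that route sits at order `4` (`QuarticGate`, stmt-AnomalousDissipation-11464; cf. Question 1.2
ibid.: `M_d(y) ≻ 0` does not suffice in even degree `2d` for `n ≥ 3`).

Rendering. `ℝⁿ = Fin n → ℝ` with its product Borel σ-algebra; multi-indices `α : Fin n →₀ ℕ`,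
`|α| = α.sum (fun _ e => e)` (as in `MvPolynomial.totalDegree`); `𝒫_k = {p : MvPolynomial (Fin n) ℝ |
p.totalDegree ≤ k}`; the data `y : (Fin n →₀ ℕ) → ℝ` (values at `|α| > k` are never used);
`L_y(p) = Σ_{α ∈ supp p} coeff_α(p) · y_α`; "supported in `K`" for closed `K` is `μ Kᶜ = 0`;
"positive Borel measure with `y_α = ∫ x^α dμ`" is a `Measure` under which every monomial of degree
`≤ k` is integrable with the stated integral (finiteness of `μ` is the case `α = 0`). A DEFINITION of
the statement (named fact, review-queued), no proof; users take `(h : FialkowNie2010_thm13)`.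

Mathlib/tree search: nothing on truncated moment problems, Riesz functionals of moment sequences,
moment matrices or flat extensions (`lean search 'truncated moment|Riesz functional|moment matrix|
representing measure'`: no hits); Mathlib has `MvPolynomial.totalDegree`, `MvPolynomial.eval`,
`MeasureTheory.Integrable`, product Borel structure on `Fin n → ℝ` — all used, nothing duplicated.
-/

namespace Literature.MeasureTheory.Moments

open _root_.MeasureTheory

/-- **Fialkow–Nie 2010, Theorem 1.3** (truncated `K`-moment problem). Let `K ⊆ ℝⁿ` be closed and
determining of degree `k` (a polynomial of degree `≤ k` vanishing on `K` is zero), and let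
`y = (y_α)_{|α| ≤ k}` be a truncated moment sequence whose Riesz functional
`L_y(p) = Σ_α p_α y_α` is strictly `K`-positive on the polynomials of degree `≤ k`
(`p|_K ≥ 0 ⟹ L_y(p) ≥ 0`, and `> 0` unless `p|_K ≡ 0`). Then `y` has a `K`-representing measure:
a positive Borel measure `μ` on `ℝⁿ` supported in `K` with `∫ x^α dμ = y_α` for all `|α| ≤ k`.
For `k = 3`, `K = ℝⁿ` this says: third moments are unconstrained once `M_1(y) ≻ 0` (grounds the
parity mechanism of `Summit.AnomalousDissipation.AnomalousDissipation.Theses.MomentParity.CubicParityLoud`).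
[cite: FialkowNie2010, Thm 1.3] -/
def FialkowNie2010_thm13 : Prop :=
  ∀ (n k : ℕ) (K : Set (Fin n → ℝ)), IsClosed K →
    (∀ p : MvPolynomial (Fin n) ℝ, p.totalDegree ≤ k →
      (∀ x ∈ K, MvPolynomial.eval x p = 0) → p = 0) →
    ∀ y : (Fin n →₀ ℕ) → ℝ,
      (∀ p : MvPolynomial (Fin n) ℝ, p.totalDegree ≤ k → (∀ x ∈ K, 0 ≤ MvPolynomial.eval x p) →
        0 ≤ ∑ α ∈ p.support, p.coeff α * y α) →
      (∀ p : MvPolynomial (Fin n) ℝ, p.totalDegree ≤ k → (∀ x ∈ K, 0 ≤ MvPolynomial.eval x p) →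
        (∃ x ∈ K, MvPolynomial.eval x p ≠ 0) → 0 < ∑ α ∈ p.support, p.coeff α * y α) →
      ∃ μ : Measure (Fin n → ℝ), μ Kᶜ = 0 ∧
        ∀ α : Fin n →₀ ℕ, (α.sum fun _ e => e) ≤ k →
          Integrable (fun x : Fin n → ℝ => ∏ i, x i ^ α i) μ ∧
            ∫ x, ∏ i, x i ^ α i ∂μ = y α

end Literature.MeasureTheory.Moments
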